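/-
Copyright (c) 2026 the pub-hodgecm-mathlib formalisation cell (harness21).  Prover seat hodgecm-mathlib-K2E5-p16 (g6), Track B «K2-LIT»,
#184♮ = hLiu418 = `stmt-HodgeConjecture-24832`; S2-asm road (γ), K2Liu-p05 (g5)'s FILE 3 census gap (G1) «MULTI-PLACE COMPACT PICTURE EXISTS», part (G1-a)
(one place, frame-free): a continuous right-`U(2)`-finite function on `U(2)` IS the evaluation `u ↦ ev_u r` of an element `r` of the S2-K carrier
`𝒜 = ℂ[u_{ij}, det⁻¹]` — the conjugate entries of ★ `exists_mvPolynomial_of_finiteDimensional_span_rightTranslates`'s polynomial become carrier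
letters on unitary `u` through `ū_{ij} = adj(u)_{ji}·det(u)⁻¹`.  THEOREMS ONLY (no `def`, no `instance`, no notation, no `sorry`).
-/
import Summits.HodgeConjecture.HodgeConjecture.Theorems.K2LiuCompactUnitaryFiniteFunctionsPolynomial   -- ★ (K∞-str) polynomiality on compact unitary groups
import Summits.HodgeConjecture.HodgeConjecture.Theorems.K2LiuU22CompactPictureDefs                    -- ★ S2-K carrier `Carrier`, `uMat`, `dInv`, `evalAt`
import HarnessLib

/-!
# Crux `HLiu418`, S2-asm (γ) (G1-a): right-`U(2)`-finite continuous functions on `U(2)` are evaluations of carrier elements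

Cell `hodgecm-mathlib`, crux item hLiu418 = `stmt-HodgeConjecture-24832` (helper lane `--supports`, count-neutral).

* `conjTranspose_eq_inv_det_smul_adjugate`, `conj_apply_eq_adjugate_mul_inv_det` — on a unitary `u`: `ū_{ij} = adj(u)_{ji} · det(u)⁻¹`;
* `evalAt_adjugate` — `ev_g ((adj u_𝒜)_{ij}) = (adj g)_{ij}`;
* `exists_carrier_eval_sumElim` — every polynomial in the entries and the conjugate entries is, ON UNITARY `u`, the evaluation of the carrier element
  `aeval (Sum.elim u_𝒜 (adj(u_𝒜)ᵀ · D⁻¹)) P`;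
* **`exists_carrier_of_rightFinite`** — a continuous `φ : U(2) → ℂ` whose right translates span a finite-dimensional space is `u ↦ ev_u r` for some
  `r ∈ 𝒜` (★ `exists_mvPolynomial_of_finiteDimensional_span_rightTranslates` at `K := ⊤ ≤ U(2)` + the previous bullet).
This is the per-factor input of (G1-b) (multi-place compact picture in ★ `MCarrier` through ★ `slotHom` ∕ ★ `evM_prod`, 2c-inst Σ∏).
References: [LeeZhu1998, §5 p. 5032]; [BrockerTomDieck1985, Ch. III (4.1), (1.2)]; [Knapp1986, Ch. VIII §3].
HONEST LABEL: HC_CM is proved only modulo the 7 printed citations (2 remaining named inputs: hLiu418 = stmt-HodgeConjecture-24832,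
h413 = stmt-HodgeConjecture-24833) until rung 0 closes; count-neutral helper, closes no socket.
-/

set_option autoImplicit false
set_option linter.dupNamespace false

noncomputable section

open scoped ComplexConjugate Matrix
open MvPolynomial Matrix
open Summit.HodgeConjecture.HodgeConjecture.Cruxes.HLiu418.K2LiuU22CompactPictureDefs
open Summit.HodgeConjecture.HodgeConjecture.Cruxes.HLiu418.K2LiuCompactGroupFiniteFunctions (exists_mvPolynomial_of_finiteDimensional_span_rightTranslates)

namespace Summit.HodgeConjecture.HodgeConjecture.Cruxes.HLiu418.K2LiuU22CarrierOfFiniteFunction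

/-! ## §1  Conjugate entries of a unitary matrix are carrier letters -/

/-- unitary ⇒ `det ≠ 0`. [folklore] -/
theorem det_ne_zero_of_conjTranspose_mul_self {n : Type*} [Fintype n] [DecidableEq n] {u : Matrix n n ℂ} (hu : uᴴ * u = 1) : u.det ≠ 0 :=
  (Matrix.isUnit_det_of_left_inverse hu).ne_zero

/-- on a unitary matrix, `uᴴ = det(u)⁻¹ • adj(u)`. [folklore] -/
theorem conjTranspose_eq_inv_det_smul_adjugate {n : Type*} [Fintype n] [DecidableEq n] {u : Matrix n n ℂ} (hu : uᴴ * u = 1) :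
    uᴴ = (u.det)⁻¹ • u.adjugate := by
  rw [← Matrix.inv_eq_left_inv hu, Matrix.inv_def, Ring.inverse_eq_inv']

/-- **`ū_{ij} = adj(u)_{ji} · det(u)⁻¹` on a unitary `u`.** [folklore] -/
theorem conj_apply_eq_adjugate_mul_inv_det {n : Type*} [Fintype n] [DecidableEq n] {u : Matrix n n ℂ} (hu : uᴴ * u = 1) (i j : n) :
    conj (u i j) = u.adjugate j i * (u.det)⁻¹ := by
  have h := congrFun (congrFun (conjTranspose_eq_inv_det_smul_adjugate hu) j) i
  rw [conjTranspose_apply, Matrix.smul_apply, smul_eq_mul] at h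
  rw [mul_comm, ← h]
  rfl

/-- `ev_g ((adj u_𝒜)_{ij}) = (adj g)_{ij}`. [cite: LeeZhu1998, p. 5032] -/
theorem evalAt_adjugate (g : Matrix (Fin 2) (Fin 2) ℂ) (hg : g.det ≠ 0) (i j : Fin 2) : evalAt g hg (uMat.adjugate i j) = g.adjugate i j := by
  have hmap : uMat.map (evalAt g hg) = g := by
    ext k l
    exact evalAt_uMat g hg k l
  have h := AlgHom.map_adjugate (evalAt g hg) uMat
  rw [AlgHom.mapMatrix_apply, AlgHom.mapMatrix_apply, hmap] at h
  have hij := congrFun (congrFun h i) j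
  rw [Matrix.map_apply] at hij
  exact hij

/-- **POLYNOMIALS IN `(u, ū)` ARE CARRIER EVALUATIONS ON UNITARY `u`**: for `P ∈ ℂ[x_{ij}, y_{ij}]`,
`P(u, ū) = ev_u (aeval (u_𝒜, adj(u_𝒜)ᵀ·D⁻¹) P)` whenever `uᴴu = 1`. [cite: LeeZhu1998, p. 5032] -/
theorem exists_carrier_eval_sumElim (P : MvPolynomial ((Fin 2 × Fin 2) ⊕ (Fin 2 × Fin 2)) ℂ) :
    ∃ r : Carrier, ∀ (u : Matrix (Fin 2) (Fin 2) ℂ) (hu : uᴴ * u = 1),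
      MvPolynomial.eval (Sum.elim (fun ij : Fin 2 × Fin 2 => u ij.1 ij.2) (fun ij : Fin 2 × Fin 2 => conj (u ij.1 ij.2))) P =
        evalAt u (det_ne_zero_of_conjTranspose_mul_self hu) r := by
  refine ⟨MvPolynomial.aeval (Sum.elim (fun ij : Fin 2 × Fin 2 => uMat ij.1 ij.2) (fun ij : Fin 2 × Fin 2 => uMat.adjugate ij.2 ij.1 * dInv)) P,
    fun u hu => ?_⟩
  rw [MvPolynomial.comp_aeval_apply, ← MvPolynomial.coe_aeval_eq_eval]
  refine congrFun (congrArg (fun f => ⇑(MvPolynomial.aeval (R := ℂ) (S₁ := ℂ) f)) (funext fun v => ?_)) P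
  rcases v with ij | ij
  · simp only [Sum.elim_inl, evalAt_uMat]
  · simp only [Sum.elim_inr, map_mul, evalAt_adjugate, evalAt_dInv, conj_apply_eq_adjugate_mul_inv_det hu]

/-! ## §2  Right-`U(2)`-finite functions -/

/-- transporting a right-finite function on `U(2)` to the subgroup `⊤ ≤ U(2)` keeps the span of right translates finite-dimensional. [folklore] -/
theorem finiteDimensional_span_rightTranslates_top (φ : Matrix.unitaryGroup (Fin 2) ℂ → ℂ)
    (hfin : FiniteDimensional ℂ (Submodule.span ℂ (Set.range fun k₀ : Matrix.unitaryGroup (Fin 2) ℂ =>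
      fun k : Matrix.unitaryGroup (Fin 2) ℂ => φ (k * k₀)))) :
    FiniteDimensional ℂ (Submodule.span ℂ (Set.range fun k₀ : (⊤ : Subgroup (Matrix.unitaryGroup (Fin 2) ℂ)) =>
      fun k : (⊤ : Subgroup (Matrix.unitaryGroup (Fin 2) ℂ)) => φ ((k : Matrix.unitaryGroup (Fin 2) ℂ) * (k₀ : Matrix.unitaryGroup (Fin 2) ℂ)))) := by
  -- the restriction map `F ↦ F ∘ Subtype.val` carries the span onto the span
  let res : (Matrix.unitaryGroup (Fin 2) ℂ → ℂ) →ₗ[ℂ] ((⊤ : Subgroup (Matrix.unitaryGroup (Fin 2) ℂ)) → ℂ) :=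
    LinearMap.funLeft ℂ ℂ (fun k : (⊤ : Subgroup (Matrix.unitaryGroup (Fin 2) ℂ)) => (k : Matrix.unitaryGroup (Fin 2) ℂ))
  have hle : Submodule.span ℂ (Set.range fun k₀ : (⊤ : Subgroup (Matrix.unitaryGroup (Fin 2) ℂ)) =>
        fun k : (⊤ : Subgroup (Matrix.unitaryGroup (Fin 2) ℂ)) => φ ((k : Matrix.unitaryGroup (Fin 2) ℂ) * (k₀ : Matrix.unitaryGroup (Fin 2) ℂ))) ≤
      (Submodule.span ℂ (Set.range fun k₀ : Matrix.unitaryGroup (Fin 2) ℂ => fun k : Matrix.unitaryGroup (Fin 2) ℂ => φ (k * k₀))).map res := by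
    rw [Submodule.span_le]
    rintro _ ⟨k₀, rfl⟩
    rw [Submodule.map_coe]
    exact ⟨fun k => φ (k * k₀), Submodule.subset_span ⟨(k₀ : Matrix.unitaryGroup (Fin 2) ℂ), rfl⟩, rfl⟩
  haveI : FiniteDimensional ℂ ((Submodule.span ℂ (Set.range fun k₀ : Matrix.unitaryGroup (Fin 2) ℂ =>
      fun k : Matrix.unitaryGroup (Fin 2) ℂ => φ (k * k₀))).map res) := Module.Finite.map _ _
  exact Submodule.finiteDimensional_of_le hle

/-- **A CONTINUOUS RIGHT-`U(2)`-FINITE FUNCTION ON `U(2)` IS A CARRIER EVALUATION**: `φ u = ev_u r` for some `r ∈ 𝒜 = ℂ[u_{ij}, det⁻¹]`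
(★ polynomiality on the compact group `U(2)` in the entries and their conjugates + §1). [cite: BrockerTomDieck1985, Ch. III (4.1)] [cite: LeeZhu1998, §5 p. 5032] -/
theorem exists_carrier_of_rightFinite (φ : Matrix.unitaryGroup (Fin 2) ℂ → ℂ) (hφ : Continuous φ)
    (hfin : FiniteDimensional ℂ (Submodule.span ℂ (Set.range fun k₀ : Matrix.unitaryGroup (Fin 2) ℂ =>
      fun k : Matrix.unitaryGroup (Fin 2) ℂ => φ (k * k₀)))) :
    ∃ r : Carrier, ∀ u : Matrix.unitaryGroup (Fin 2) ℂ,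
      φ u = evalAt (u : Matrix (Fin 2) (Fin 2) ℂ) (det_ne_zero_of_conjTranspose_mul_self (Matrix.mem_unitaryGroup_iff'.1 u.2)) r := by
  obtain ⟨P, hP⟩ := exists_mvPolynomial_of_finiteDimensional_span_rightTranslates (⊤ : Subgroup (Matrix.unitaryGroup (Fin 2) ℂ))
    (by rw [Subgroup.coe_top]; exact isClosed_univ)
    (fun k => φ (k : Matrix.unitaryGroup (Fin 2) ℂ)) (hφ.comp continuous_subtype_val) (finiteDimensional_span_rightTranslates_top φ hfin)
  obtain ⟨r, hr⟩ := exists_carrier_eval_sumElim P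
  refine ⟨r, fun u => ?_⟩
  rw [← hr (u : Matrix (Fin 2) (Fin 2) ℂ) (Matrix.mem_unitaryGroup_iff'.1 u.2)]
  exact hP ⟨u, Subgroup.mem_top u⟩

end Summit.HodgeConjecture.HodgeConjecture.Cruxes.HLiu418.K2LiuU22CarrierOfFiniteFunction

end
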